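import Summits.Ventures.PercRepro.Night2LineAny
import Summits.Ventures.PercRepro.Night2LineLongCell

/-!
# night-2: THE MEDIUM-LINE CELL — h21's cell `(2, 1)` for `V` = a line of `≥ L₀` points plus `8 … p₀` points (gen 38)

`anyLineIncome d k = Σ_{j ≤ d} C(d, j) · [7 ≤ j] · 3 / lineFaceBound (j + 2) (k + 5)` is the income of the any-line targets
(`basis_pair_fair_of_any_line`), monotone in `d` and antitone in `k` (**`basis_pair_fair_of_any_line_of_le`**).  For a line
`ℓ = cl {a′, b′}` with `≥ L₀` points of `V` and `8 ≤ |V ∖ ℓ| ≤ p₀`: a basis pair with two basis points on `ℓ` has `d ≥ L₀ − 2`,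
`3 ≤ k ≤ p₀ − 3` (the basis-line theorem, `lineIncome (L₀ − 2) (p₀ − 3) ≥ 1`); with at most one basis point on `ℓ` it has
`d ≥ L₀ − 1`, `3 ≤ k ≤ p₀ − 4` (the any-line theorem, `anyLineIncome (L₀ − 1) (p₀ − 4) ≥ 1`): **`basis_pair_fair_of_medium_line`**,
**`localShadowHall_two_one_of_medium_line`**; the instances `(L₀, p₀) = (13, 10), (15, 19), (17, 30), (20, 56)`.
Paper: proofs/NIGHT-2-g38.md §4.
-/

namespace PercRepro.Shadow

open PercRepro.ThmH PercRepro.PerFlat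

variable {α : Type*} [DecidableEq α] {M : Matroid α} [M.Finite] {G : Finset α}

/-- The any-line income: `Σ_{j ≤ d} C(d, j) · [7 ≤ j] · 3 / lineFaceBound (j + 2) (k + 5)`. -/
noncomputable def anyLineIncome (d k : ℕ) : ℚ :=
  ∑ j ∈ Finset.range (d + 1), ((d.choose j : ℕ) : ℚ) *
    (if 7 ≤ j then 3 / ((lineFaceBound (j + 2) (k + 5) : ℕ) : ℚ) else 0)

/-- The summand of the any-line income is nonnegative. -/
theorem anyLineIncome_term_nonneg (d j k : ℕ) :
    0 ≤ ((d.choose j : ℕ) : ℚ) * (if 7 ≤ j then 3 / ((lineFaceBound (j + 2) (k + 5) : ℕ) : ℚ) else 0) := by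
  apply mul_nonneg (by positivity)
  split_ifs
  · positivity
  · exact le_refl _

/-- The any-line income is increasing in `d`. -/
theorem anyLineIncome_le_succ (d k : ℕ) : anyLineIncome d k ≤ anyLineIncome (d + 1) k := by
  unfold anyLineIncome
  rw [Finset.sum_range_succ _ (d + 1)]
  refine le_trans ?_ (le_add_of_nonneg_right (anyLineIncome_term_nonneg (d + 1) (d + 1) k))
  apply Finset.sum_le_sum
  intro j _
  apply mul_le_mul_of_nonneg_right _ (by split_ifs <;> positivity)
  exact_mod_cast Nat.choose_le_succ d j

/-- The any-line income is monotone in `d`. -/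
theorem anyLineIncome_mono_left {d₀ d : ℕ} (h : d₀ ≤ d) (k : ℕ) : anyLineIncome d₀ k ≤ anyLineIncome d k := by
  induction h with
  | refl => exact le_refl _
  | step _ ih => exact ih.trans (anyLineIncome_le_succ _ k)

/-- The any-line income is antitone in `k`. -/
theorem anyLineIncome_anti_right (d : ℕ) {k k₀ : ℕ} (h : k ≤ k₀) : anyLineIncome d k₀ ≤ anyLineIncome d k := by
  unfold anyLineIncome
  apply Finset.sum_le_sum
  intro j _
  apply mul_le_mul_of_nonneg_left _ (by positivity)
  split_ifs with h7
  · have hpos : (0 : ℚ) < ((lineFaceBound (j + 2) (k + 5) : ℕ) : ℚ) := by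
      exact_mod_cast lineFaceBound_pos' (by omega) (by omega)
    apply div_le_div_of_nonneg_left (by norm_num) hpos
    exact_mod_cast lineFaceBound_mono (le_refl _) (by omega)
  · exact le_refl _

/-- **The any-line theorem, monotone form**: `d₀ ≤ |W ∩ cl {a, b}|`, `|Y_O| ≤ k₀`, `1 ≤ anyLineIncome d₀ k₀` give the fair share. -/
theorem basis_pair_fair_of_any_line_of_le (hG : G ∈ flatsQ M (5 + 1)) (hd : (gr M \ G).card = 2)
    (hk : kColoops M G = 1) (hs : ∀ e ∈ gr M, ∀ f ∈ gr M, e ≠ f → rkN M {e, f} = 2)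
    (hl : ∀ e ∈ gr M, M.Indep {e}) (hnf : fatClosures M 5 G 2 = ∅) {B : Finset α}
    (hB : B ∈ thinMembers M 5 G) (hnP : ¬ bigP M G B) {z : α} (hz : z ∈ G \ clF M B)
    (hl0 : loss M 5 G B z ≠ 0) (a b : α) {YO : Finset α}
    (hYO : YO ⊆ (G \ insert z B) \ clF M {a, b}) (h3 : 3 ≤ YO.card)
    (hrk : rkN M (((G \ insert z B) \ clF M {a, b}) \ YO) ≤ 1) {d₀ k₀ : ℕ}
    (hd₀ : d₀ ≤ ((G \ insert z B) ∩ clF M {a, b}).card) (hk₀ : YO.card ≤ k₀) (hS : 1 ≤ anyLineIncome d₀ k₀) :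
    loss M 5 G B z ≤ rhoL M 5 G B z * lossIncomeH M 5 G (bigP M G) (dshGT2 M 5 G) B z := by
  apply basis_pair_fair_of_any_line hG hd hk hs hl hnf hB hnP hz hl0 a b hYO h3 hrk
  have h1 := anyLineIncome_mono_left hd₀ k₀
  have h2 := anyLineIncome_anti_right ((G \ insert z B) ∩ clF M {a, b}).card hk₀
  unfold anyLineIncome at h1 h2 hS
  linarith

/-- **THE MEDIUM-LINE CELL for lossy basis pairs**: `L₀ ≤ |V ∩ ℓ|`, `8 ≤ |V ∖ ℓ| ≤ p₀`, `1 ≤ lineIncome (L₀ − 2) (p₀ − 3)`,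
`1 ≤ anyLineIncome (L₀ − 1) (p₀ − 4)`. -/
theorem basis_pair_fair_of_medium_line (hG : G ∈ flatsQ M (5 + 1)) (hd : (gr M \ G).card = 2)
    (hk : kColoops M G = 1) (hs : ∀ e ∈ gr M, ∀ f ∈ gr M, e ≠ f → rkN M {e, f} = 2)
    (hl : ∀ e ∈ gr M, M.Indep {e}) (hnf : fatClosures M 5 G 2 = ∅) {B : Finset α}
    (hB : B ∈ thinMembers M 5 G) (hnP : ¬ bigP M G B) {z : α} (hz : z ∈ G \ clF M B)
    (hl0 : loss M 5 G B z ≠ 0) {a' b' : α} (ha' : a' ∈ G \ coloops M G) (hb' : b' ∈ G \ coloops M G)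
    (hab' : a' ≠ b') {L₀ p₀ : ℕ} (hL : L₀ ≤ ((G \ coloops M G) ∩ clF M {a', b'}).card)
    (hoff8 : 8 ≤ ((G \ coloops M G) \ clF M {a', b'}).card)
    (hoff : ((G \ coloops M G) \ clF M {a', b'}).card ≤ p₀)
    (hS : 1 ≤ lineIncome (L₀ - 2) (p₀ - 3)) (hS' : 1 ≤ anyLineIncome (L₀ - 1) (p₀ - 4)) :
    loss M 5 G B z ≤ rhoL M 5 G B z * lossIncomeH M 5 G (bigP M G) (dshGT2 M 5 G) B z := by
  have hGg : G ⊆ gr M := (mem_flatsQ.1 hG).1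
  have hQG : insert z B ⊆ G := Finset.insert_subset (Finset.mem_sdiff.1 hz).1 (subset_G_of_mem_thinMembers hB)
  have hd' : (gr M \ G).card ≤ 5 := by omega
  have hKB : coloops M G ⊆ B := coloops_subset_of_mem_thinMembers hG hd' hB
  obtain ⟨-, hQ'5⟩ := rkN_insert_sdiff_coloops_eq_five hG hd hk hB hnP hz
  have ha'g : a' ∈ gr M := hGg (Finset.mem_sdiff.1 ha').1
  have hb'g : b' ∈ gr M := hGg (Finset.mem_sdiff.1 hb').1
  have hind : M.Indep ((insert z B \ coloops M G : Finset α) : Set α) :=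
    (indep_insert_of_basis_pair hG hd hk hB hnP hz).subset (by exact_mod_cast (Finset.sdiff_subset))
  -- `V = Q′ ⊔ W`
  have hVsplit : (G \ coloops M G) = (insert z B \ coloops M G) ∪ (G \ insert z B) := by
    ext x
    simp only [Finset.mem_sdiff, Finset.mem_union]
    constructor
    · rintro ⟨hxG, hxK⟩
      by_cases hxQ : x ∈ insert z B
      · exact Or.inl ⟨hxQ, hxK⟩
      · exact Or.inr ⟨hxG, hxQ⟩
    · rintro (⟨hxQ, hxK⟩ | ⟨hxG, hxQ⟩)
      · exact ⟨hQG hxQ, hxK⟩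
      · refine ⟨hxG, fun hxK => hxQ (Finset.mem_insert_of_mem (hKB hxK))⟩
  have hdisj : Disjoint (insert z B \ coloops M G) (G \ insert z B) := by
    rw [Finset.disjoint_left]
    intro x hx hx'
    exact (Finset.mem_sdiff.1 hx').2 (Finset.mem_sdiff.1 hx).1
  have hQ'split := Finset.card_sdiff_add_card_inter (insert z B \ coloops M G) (clF M {a', b'})
  have hon_eq : ((G \ coloops M G) ∩ clF M {a', b'}).card =
      ((insert z B \ coloops M G) ∩ clF M {a', b'}).card + ((G \ insert z B) ∩ clF M {a', b'}).card := by
    rw [hVsplit, Finset.union_inter_distrib_right, Finset.card_union_of_disjoint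
      (Finset.disjoint_of_subset_left Finset.inter_subset_left
        (Finset.disjoint_of_subset_right Finset.inter_subset_left hdisj))]
  have hoff_eq : ((G \ coloops M G) \ clF M {a', b'}).card =
      ((insert z B \ coloops M G) \ clF M {a', b'}).card + ((G \ insert z B) \ clF M {a', b'}).card := by
    rw [hVsplit, Finset.union_sdiff_distrib, Finset.card_union_of_disjoint
      (Finset.disjoint_of_subset_left Finset.sdiff_subset (Finset.disjoint_of_subset_right Finset.sdiff_subset hdisj))]
  have hQ'ℓ2 : ((insert z B \ coloops M G) ∩ clF M {a', b'}).card ≤ 2 :=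
    card_inter_clF_pair_le_two_of_indep hind
  rcases Nat.lt_or_ge ((insert z B \ coloops M G) ∩ clF M {a', b'}).card 2 with hlt | hge
  · -- at most one basis point on the line: the any-line theorem with `Y_O = W ∖ ℓ`
    apply basis_pair_fair_of_any_line_of_le hG hd hk hs hl hnf hB hnP hz hl0 a' b' (Finset.Subset.refl _)
      (by omega) ?_ (d₀ := L₀ - 1) (k₀ := p₀ - 4) (by omega) (by omega) hS'
    rw [Finset.sdiff_self]
    have := rkN_le_card (M := M) (∅ : Finset α)
    rw [Finset.card_empty] at this
    omega
  · -- two basis points `a, b` on the line: the basis-line theorem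
    obtain ⟨a, ha, b, hb, hab⟩ := Finset.one_lt_card.1 hge
    have haQ' := (Finset.mem_inter.1 ha).1
    have hbQ' := (Finset.mem_inter.1 hb).1
    have hag : a ∈ gr M := hGg (hQG (Finset.mem_sdiff.1 haQ').1)
    have hbg : b ∈ gr M := hGg (hQG (Finset.mem_sdiff.1 hbQ').1)
    have heq : clF M {a, b} = clF M {a', b'} :=
      clF_pair_eq_of_mem hs ha'g hb'g hab' hag hbg hab (Finset.mem_inter.1 ha).2 (Finset.mem_inter.1 hb).2
    rw [← heq] at hon_eq hoff_eq hQ'split hQ'ℓ2 hge hL hoff8 hoff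
    apply basis_pair_fair_of_line_of_le hG hd hk hs hl hnf hB hnP hz hl0 haQ' hbQ' hab (Finset.Subset.refl _)
      (by omega) ?_ (d₀ := L₀ - 2) (k₀ := p₀ - 3) (by omega) (by omega) hS
    rw [Finset.sdiff_self]
    have := rkN_le_card (M := M) (∅ : Finset α)
    rw [Finset.card_empty] at this
    omega

/-- **The cell `(2, 1)` with no fat closure for the medium-line configurations.** -/
theorem localShadowHall_nonfat_of_medium_line (hG : G ∈ flatsQ M (5 + 1)) (hd : (gr M \ G).card = 2)
    (hk : kColoops M G = 1) (hs : ∀ e ∈ gr M, ∀ f ∈ gr M, e ≠ f → rkN M {e, f} = 2)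
    (hl : ∀ e ∈ gr M, M.Indep {e}) (hnf : fatClosures M 5 G 2 = ∅) {a' b' : α}
    (ha' : a' ∈ G \ coloops M G) (hb' : b' ∈ G \ coloops M G) (hab' : a' ≠ b') {L₀ p₀ : ℕ}
    (hL : L₀ ≤ ((G \ coloops M G) ∩ clF M {a', b'}).card)
    (hoff8 : 8 ≤ ((G \ coloops M G) \ clF M {a', b'}).card)
    (hoff : ((G \ coloops M G) \ clF M {a', b'}).card ≤ p₀)
    (hS : 1 ≤ lineIncome (L₀ - 2) (p₀ - 3)) (hS' : 1 ≤ anyLineIncome (L₀ - 1) (p₀ - 4)) :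
    LocalShadowHall M 5 G := by
  have hfat : (fatClosures M 5 G 2).card ≤ 1 := by
    rw [hnf, Finset.card_empty]
    exact zero_le_one
  apply localShadowHall_of_gt2_of_basis_fair hG hd hk hs hl hfat
  intro B hB hnP z hz
  by_cases hl0 : loss M 5 G B z = 0
  · rw [hl0]
    have hd' : (gr M \ G).card ≤ 5 := by omega
    have h1 : 0 ≤ rhoL M 5 G B z := by
      unfold rhoL
      rw [hl0]
      simp
    have h2 : 0 ≤ lossIncomeH M 5 G (bigP M G) (dshGT2 M 5 G) B z :=
      lossIncomeH_nonneg hG hd' (column_side_gt2 hG hd hk hs hl hfat) B z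
    positivity
  · exact basis_pair_fair_of_medium_line hG hd hk hs hl hnf hB hnP hz hl0 ha' hb' hab' hL hoff8 hoff hS hS'

/-- **h21's cell `(2, 1)` for the medium-line configurations** (`L₀ ≤ |V ∩ ℓ|`, `8 ≤ |V ∖ ℓ| ≤ p₀`, the two incomes `≥ 1`). -/
theorem localShadowHall_two_one_of_medium_line (hG : G ∈ flatsQ M (5 + 1)) (hd : (gr M \ G).card = 2)
    (hk : kColoops M G = 1) (hs : ∀ e ∈ gr M, ∀ f ∈ gr M, e ≠ f → rkN M {e, f} = 2)
    (hl : ∀ e ∈ gr M, M.Indep {e}) {a' b' : α} (ha' : a' ∈ G \ coloops M G) (hb' : b' ∈ G \ coloops M G)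
    (hab' : a' ≠ b') {L₀ p₀ : ℕ} (hL : L₀ ≤ ((G \ coloops M G) ∩ clF M {a', b'}).card)
    (hoff8 : 8 ≤ ((G \ coloops M G) \ clF M {a', b'}).card)
    (hoff : ((G \ coloops M G) \ clF M {a', b'}).card ≤ p₀)
    (hS : 1 ≤ lineIncome (L₀ - 2) (p₀ - 3)) (hS' : 1 ≤ anyLineIncome (L₀ - 1) (p₀ - 4)) :
    LocalShadowHall M 5 G := by
  rcases Nat.lt_or_ge (fatClosures M 5 G 2).card 2 with hlt | hge
  · rcases Nat.lt_or_ge (fatClosures M 5 G 2).card 1 with h0 | h1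
    · have hnf : fatClosures M 5 G 2 = ∅ := Finset.card_eq_zero.1 (by omega)
      exact localShadowHall_nonfat_of_medium_line hG hd hk hs hl hnf ha' hb' hab' hL hoff8 hoff hS hS'
    · obtain ⟨B₀, hB₀, hm₀⟩ := exists_fat_member_of_card_eq_one hG hd (by omega)
      exact localShadowHall_fat hG hd hk hs hl (by omega) hB₀ hm₀
  · exact localShadowHall_two_one_five_fatClosures_free hG hd hk hs hl hge

/-- `lineIncome 11 7 ≥ 1` and `anyLineIncome 12 6 ≥ 1`: the cell `(L₀, p₀) = (13, 10)`. -/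
theorem medium_line_thirteen_ten : 1 ≤ lineIncome (13 - 2) (10 - 3) ∧ 1 ≤ anyLineIncome (13 - 1) (10 - 4) := by
  constructor <;> (simp only [lineIncome, anyLineIncome, lineFaceBound, Finset.sum_range_succ, Finset.sum_range_zero]; norm_num [Nat.choose])

/-- The cell `(L₀, p₀) = (15, 19)`. -/
theorem medium_line_fifteen_nineteen : 1 ≤ lineIncome (15 - 2) (19 - 3) ∧ 1 ≤ anyLineIncome (15 - 1) (19 - 4) := by
  constructor <;> (simp only [lineIncome, anyLineIncome, lineFaceBound, Finset.sum_range_succ, Finset.sum_range_zero]; norm_num [Nat.choose])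

/-- The cell `(L₀, p₀) = (17, 30)`. -/
theorem medium_line_seventeen_thirty : 1 ≤ lineIncome (17 - 2) (30 - 3) ∧ 1 ≤ anyLineIncome (17 - 1) (30 - 4) := by
  constructor <;> (simp only [lineIncome, anyLineIncome, lineFaceBound, Finset.sum_range_succ, Finset.sum_range_zero]; norm_num [Nat.choose])

/-- The cell `(L₀, p₀) = (20, 56)`. -/
theorem medium_line_twenty_fiftysix : 1 ≤ lineIncome (20 - 2) (56 - 3) ∧ 1 ≤ anyLineIncome (20 - 1) (56 - 4) := by
  constructor <;> (simp only [lineIncome, anyLineIncome, lineFaceBound, Finset.sum_range_succ, Finset.sum_range_zero]; norm_num [Nat.choose])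

/-- **h21's cell `(2, 1)` for `V` = a line of `≥ 15` points plus `8 … 19` points.** -/
theorem localShadowHall_two_one_of_line_fifteen (hG : G ∈ flatsQ M (5 + 1)) (hd : (gr M \ G).card = 2)
    (hk : kColoops M G = 1) (hs : ∀ e ∈ gr M, ∀ f ∈ gr M, e ≠ f → rkN M {e, f} = 2)
    (hl : ∀ e ∈ gr M, M.Indep {e}) {a' b' : α} (ha' : a' ∈ G \ coloops M G) (hb' : b' ∈ G \ coloops M G)
    (hab' : a' ≠ b') (hL : 15 ≤ ((G \ coloops M G) ∩ clF M {a', b'}).card)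
    (hoff8 : 8 ≤ ((G \ coloops M G) \ clF M {a', b'}).card)
    (hoff : ((G \ coloops M G) \ clF M {a', b'}).card ≤ 19) : LocalShadowHall M 5 G :=
  localShadowHall_two_one_of_medium_line hG hd hk hs hl ha' hb' hab' hL hoff8 hoff
    medium_line_fifteen_nineteen.1 medium_line_fifteen_nineteen.2

end PercRepro.Shadow
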